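import Summits.AtomisticToContinuum.HydrodynamicLimit.Theses.JParityClosure
import Summits.AtomisticToContinuum.HydrodynamicLimit.Theorems.JParityClosureParityBandClosureExactParityRigidity
import Summits.AtomisticToContinuum.HydrodynamicLimit.Theorems.JParityClosureParityBandClosureSurprisalTestContinuity
import Summits.AtomisticToContinuum.HydrodynamicLimit.Theorems.JParityClosureParityBandClosureMomentSemicontinuity
import Summits.AtomisticToContinuum.HydrodynamicLimit.Theorems.JParityClosureParityBandClosureCountableTestUpgrade
import Summits.AtomisticToContinuum.HydrodynamicLimit.Theorems.JParityClosureParityBandClosureParityStabilityOfRigidity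
import Mathlib.MeasureTheory.Measure.ProbabilityMeasure
import Mathlib.MeasureTheory.Measure.FiniteMeasure
import HarnessLib

/-!
# Parity stability (crux `JParityClosure.ParityBandClosure`, stmt-AtomisticToContinuum-17608, line
# `transfer-weighted-parity-chain`, skeleton v3): the single-pair quantitative rigidity lemma, ASSEMBLED

WHAT. `ParityStability` (verbatim the skeleton waypoint): for every moment bound `M`, floor constant `cmin > 0` and
tolerance `ε > 0` there are FINITELY many tests — bounded continuous `J`-odd marks `Ψ_j` at Gaussian-KDE bandwidths
`ϑ_j ∈ (0,1)`, nonneg bounded continuous floor marks `Ξ_j`, bounded continuous balance tests `c_j` — and `η > 0` such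
that every pair (probability law `ν` on `ℝ³` with `∫|v|³ ≤ M`, finite collision record `κ` on `(ℝ³×ℝ³)×S²` with mass
and second moments `≤ M`) passing the tests within `η` has `ε`-isotropic central second moments.

PROOF. Pure composition of the five landed v3 pieces (lead c2's wave 1): `stub_parityStabilityOfRigidity` (p165739,
Prokhorov extraction + contradiction) applied to `stub_exactParityRigidity` (p164294, the `η = 0` case = the landed
chain p139072 → p138663 → p139366 → p137939), `stub_surprisalTestContinuity` (p165357, joint weak continuity of the
Metropolis-odd functional), `stub_momentSemicontinuity` (p164742) and `stub_countableTestUpgrade` (p165416, countable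
determining test families).  Only the `def ParityStability : Prop` waypoint is restated VERBATIM (it is syntactically identical
to the copy in the landed assembly file, so the landed theorem applies by `exact`).

REFERENCES. C. Cercignani, R. Illner, M. Pulvirenti, *The Mathematical Theory of Dilute Gases* (1994) §3.1–3.2
(collision invariants, H-theorem equality case); P. Billingsley, *Convergence of Probability Measures* (1999) §5
(Prokhorov).
-/

noncomputable section

namespace Summit.AtomisticToContinuum.HydrodynamicLimit.Theorems.ParityBandClosureParityStability

open scoped BigOperators Topology Classical MeasureTheory ENNReal InnerProductSpace
open Filter Set MeasureTheory
open Literature.MathematicalPhysics.KineticTheory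
open Literature.Analysis.FluidPDE

/-- **Parity stability (single pair, quantitative; the landed measure-level chain made uniform).**  For every moment
bound `M`, floor constant `cmin > 0` and `ε > 0` there are finitely many tests — bounded continuous `J`-odd marks `Ψ_j`
(`J(p,ω) = (collide ω p, −ω)`) with mollifier scales `ϑ_j ∈ (0,1)`, bounded continuous floor marks `Ξ_j ≥ 0`, bounded
continuous balance tests `c_j` — and `η > 0` such that: whenever a probability law `ν` on `ℝ³` (`∫|v|³ ≤ M`) and a finite
record `κ` on `(ℝ³×ℝ³)×S²` (mass and second moments `≤ M`) satisfy (o) `|∫Ψ_j min(1,e^{−F^ν_{ϑ_j}}) dκ| ≤ η`,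
(f) `c₀∫Ξ_j B d(ν⊗ν⊗dω) ≤ ∫Ξ_j dκ + η` with `c₀ ≥ cmin`, (b) `|∫Δc_j dκ| ≤ η`, then the central second-moment tensor of `ν`
is `ε`-close to `θ𝟙` for some `θ ≥ 0`.  `F^ν_ϑ(p,ω) = log h(p.1)h(p.2) − log h(p′.1)h(p′.2)`, `h = ν ⋆ G_{ϑ²}`, `p′ = collide ω p`,
`B = hardSphereKernel (w, v) ω = ((w−v)·ω)₊` — VERBATIM the conventions of `ParityRigidity` / p138663 / p139366.  Proof route in
the file header (contradiction + tightness + continuity of `(ν,κ) ↦ ∫Ψ min(1,e^{−F^ν_ϑ})dκ` at FIXED `ϑ > 0` + the landed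
chain at every `ϑ ∈ (0,1)`).  Satisfiable hypotheses for every choice of tests (Maxwellian `ν`, `κ = c₀(ν⊗ν)B dω`), so the
`∃`-data cannot be gamed. -/
def ParityStability : Prop :=
  ∀ (M cmin ε : ℝ), 0 < cmin → 0 < ε →
    ∃ (n : ℕ) (Ψs : Fin n → (V3 × V3) × Metric.sphere (0 : V3) 1 → ℝ)
      (Ξs : Fin n → (V3 × V3) × Metric.sphere (0 : V3) 1 → ℝ) (cs : Fin n → V3 → ℝ) (ϑs : Fin n → ℝ) (η : ℝ),
      0 < η ∧
      (∀ j, Continuous (Ψs j) ∧ (∃ C : ℝ, ∀ q, |Ψs j q| ≤ C) ∧ (∀ q, Ψs j (collide q.2 q.1, -q.2) = -Ψs j q)) ∧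
      (∀ j, Continuous (Ξs j) ∧ (∀ q, 0 ≤ Ξs j q) ∧ (∃ C : ℝ, ∀ q, Ξs j q ≤ C)) ∧
      (∀ j, Continuous (cs j) ∧ (∃ C : ℝ, ∀ v, |cs j v| ≤ C)) ∧
      (∀ j, 0 < ϑs j ∧ ϑs j < 1) ∧
      ∀ (ν : Measure V3) [IsProbabilityMeasure ν] (κ : Measure ((V3 × V3) × Metric.sphere (0 : V3) 1))
        [IsFiniteMeasure κ] (c₀ : ℝ), cmin ≤ c₀ →
        Integrable (fun v : V3 => ‖v‖ ^ 3) ν → ∫ v, ‖v‖ ^ 3 ∂ν ≤ M →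
        (κ Set.univ).toReal ≤ M →
        Integrable (fun q : (V3 × V3) × Metric.sphere (0 : V3) 1 => ‖q.1.1‖ ^ 2 + ‖q.1.2‖ ^ 2) κ →
        ∫ q, (‖q.1.1‖ ^ 2 + ‖q.1.2‖ ^ 2) ∂κ ≤ M →
        let h : ℝ → V3 → ℝ := fun ϑ v => ∫ v', localMaxwellian 1 (ϑ ^ 2) v v' ∂ν
        let F : ℝ → (V3 × V3) × Metric.sphere (0 : V3) 1 → ℝ := fun ϑ q =>
          Real.log (h ϑ q.1.1) + Real.log (h ϑ q.1.2) -
            Real.log (h ϑ (collide q.2 q.1).1) - Real.log (h ϑ (collide q.2 q.1).2)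
        (∀ j, |∫ q, Ψs j q * min 1 (Real.exp (-(F (ϑs j) q))) ∂κ| ≤ η) →
        (∀ j, c₀ * ∫ q, Ξs j q * hardSphereKernel (q.1.2, q.1.1) q.2 ∂((ν.prod ν).prod sphereMeasure) ≤
          (∫ q, Ξs j q ∂κ) + η) →
        (∀ j, |∫ q, (cs j (collide q.2 q.1).1 + cs j (collide q.2 q.1).2 - cs j q.1.1 - cs j q.1.2) ∂κ| ≤ η) →
        ∃ θ : ℝ, 0 ≤ θ ∧ ∃ u : V3, (∀ j : Fin 3, |(∫ v, v j ∂ν) - u j| ≤ ε) ∧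
          ∀ j k : Fin 3, |(∫ v, (v j - u j) * (v k - u k) ∂ν) - (if j = k then θ else 0)| ≤ ε

/-- **Parity stability** (`ParityStability`, the line's single-pair quantitative rigidity lemma) — assembled from the
five landed v3 pieces: `ParityBandClosureStabilityAssembly.stub_parityStabilityOfRigidity` fed with
`ParityBandClosureExactRigidity.stub_exactParityRigidity`, `ParityBandClosureSurprisalContinuity.stub_surprisalTestContinuity`,
`ParityBandClosureMomentSemicontinuity.stub_momentSemicontinuity`, `ParityBandClosureCountableUpgrade.stub_countableTestUpgrade`. -/
theorem stub_parityStability : ParityStability :=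
  Summit.AtomisticToContinuum.HydrodynamicLimit.Theorems.ParityBandClosureStabilityAssembly.stub_parityStabilityOfRigidity
    Summit.AtomisticToContinuum.HydrodynamicLimit.Theorems.ParityBandClosureExactRigidity.stub_exactParityRigidity
    Summit.AtomisticToContinuum.HydrodynamicLimit.Theorems.ParityBandClosureSurprisalContinuity.stub_surprisalTestContinuity
    Summit.AtomisticToContinuum.HydrodynamicLimit.Theorems.ParityBandClosureMomentSemicontinuity.stub_momentSemicontinuity
    Summit.AtomisticToContinuum.HydrodynamicLimit.Theorems.ParityBandClosureCountableUpgrade.stub_countableTestUpgrade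

end Summit.AtomisticToContinuum.HydrodynamicLimit.Theorems.ParityBandClosureParityStability

end
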